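import Literature.Analysis.FunctionSpaces.BesselJProofs
import Mathlib.Analysis.SpecialFunctions.ExpDeriv
import Mathlib.Analysis.Complex.RealDeriv
import Mathlib.Analysis.SpecialFunctions.Pow.Real
import HarnessLib

/-!
# Conrey–Iwaniec (2002), §4 (4.22)–(4.23): an elementary oscillatory envelope for `J₀`

B. Conrey, H. Iwaniec, *Spacing of zeros of Hecke L-functions and the class number problem*,
Acta Arith. 103 (2002) 259–312, §4 [held text `paper:arxiv-math_0111012`, p0012]: before (4.23)
the authors write "`J_{k−1}(2πy) = W(y)e(y) + W̄(y)e(−y)` where `W(y)` is a smooth function whose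
derivatives satisfy `y^νW^{(ν)}(y) ≪ k²y^{-1/2}`, `ν = 0, 1, 2`" (Hankel's asymptotics). For the
weight-one kernels (`k = 1`) this file supplies an ELEMENTARY substitute on `u ≥ 2`, enough for the
two partial integrations of (4.23) (cell `landau-siegel/ls-inputs`, line `theta-circle-method`,
registered stub S3c `stub_bessel_kernel`; the kernel bound itself is
`ConreyIwaniec2002BesselKernel.lean`):

* the envelopes `W_ε(u) = e^{-iεu}(J₀(u) + iεJ₁(u) − iεJ₀(u)/(2u))`, `ε = ±1`, satisfy
  `J₀ = ½(e^{iu}W₊ + e^{-iu}W₋)` (`besselJ_zero_eq_envelope_sum`);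
* from the tree's `J₀' = −J₁`, `(uJ₁)' = uJ₀` alone: `W_ε' = −e^{-iεu}(uJ₀ + iεuJ₁ − iεJ₀)/(2u²)`
  (the `u^{-1/2}`-size terms cancel — this is why the correction `−iεJ₀/(2u)` is inserted),
  `W_ε'' = e^{-iεu}(2uJ₀ + iεuJ₁ − 2iεJ₀)/(2u³)` (`hasDerivAt_besselEnvelope`,
  `hasDerivAt_besselEnvelope_deriv`);
* with the tree's decay `|J_n(u)| ≤ C_n u^{-1/2}` (`abs_besselJ_le_mul_rpow_neg_half`):
  `|W_ε| ≤ K/√u`, `|W_ε'| ≤ K/(u√u)`, `|W_ε''| ≤ K/(u²√u)` for `u ≥ 2` (`besselEnvelope_bounds`).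

No Hankel functions / `Y₀` are needed. (These `W_ε` are NOT witnesses of the global interface
`BesselJZeroAmplitude` of `ConreyIwaniec2002CircleMethodDefs.lean`, whose bounds are required for
all `u > 0`; for the kernel bound small arguments are handled by the trivial bound instead.)

«The programme SEARCHES and TYPES; no claim about Landau–Siegel zeros, Theorems 1–2 of
arXiv:2211.02515 or a repaired Margin232 until a kernel theorem says so.»

## References

* [ConreyIwaniec2002] B. Conrey, H. Iwaniec, *Spacing of zeros of Hecke L-functions and the class
  number problem*, Acta Arith. 103 (2002) 259–312, arXiv:math/0111012: §4 (4.5), (4.22)–(4.24).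
* G. N. Watson, *A Treatise on the Theory of Bessel Functions* (2nd ed., 1944), §7.21 (Hankel's
  expansions; here replaced by the elementary envelope built from `J₀`, `J₁`).
-/

noncomputable section

open Complex Real Set

namespace Literature.NumberTheory.LFunctions

namespace ConreyIwaniec2002

open Literature.Analysis.FunctionSpaces

/-- The derivative of the "Hankel-type envelope" `W_ε(u) = e^{-iεu}(J₀(u) + iεJ₁(u) − iεJ₀(u)/(2u))`
(`ε = ±1`): `W_ε'(u) = −e^{-iεu}(uJ₀(u) + iεuJ₁(u) − iεJ₀(u))/(2u²)` for `u ≠ 0`, from `J₀' = −J₁`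
and `J₁' = J₀ − J₁/u`; the terms of size `u^{-1/2}` cancel. [cite: ConreyIwaniec2002, §4 before (4.23)] -/
theorem hasDerivAt_besselEnvelope {ε : ℝ} (hε : ε = 1 ∨ ε = -1) {u : ℝ} (hu : u ≠ 0) :
    HasDerivAt
      (fun v : ℝ ↦ cexp (-(I * ε * v)) *
        ((besselJ 0 v : ℂ) + I * ε * besselJ 1 v - I * ε * besselJ 0 v / (2 * v)))
      (-(cexp (-(I * ε * u)) *
        (u * besselJ 0 u + I * ε * u * besselJ 1 u - I * ε * besselJ 0 u)) / (2 * u ^ 2)) u := by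
  have hε2 : (ε : ℂ) ^ 2 = 1 := by
    rcases hε with h | h <;> simp [h]
  have huC : (u : ℂ) ≠ 0 := ofReal_ne_zero.mpr hu
  -- the exponential factor
  have hE : HasDerivAt (fun v : ℝ ↦ cexp (-(I * ε * v))) (cexp (-(I * ε * u)) * (-(I * ε))) u := by
    have h1 : HasDerivAt (fun v : ℝ ↦ -(I * ε * (v : ℂ))) (-(I * ε)) u := by
      have := ((hasDerivAt_id u).ofReal_comp).const_mul (I * ε)
      simpa using this.fun_neg
    exact h1.cexp
  -- the Bessel factors
  have hJ0 : HasDerivAt (fun v : ℝ ↦ (besselJ 0 v : ℂ)) ((-besselJ 1 u : ℝ) : ℂ) u :=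
    (hasDerivAt_besselJ_zero_holds u).ofReal_comp
  have hJ1 : HasDerivAt (fun v : ℝ ↦ (besselJ 1 v : ℂ))
      (((u * besselJ 0 u - besselJ 1 u) / u : ℝ) : ℂ) u := by
    have := (hasDerivAt_besselJ_succ_of_ne_zero 0 hu).ofReal_comp
    simpa using this
  have hinv : HasDerivAt (fun v : ℝ ↦ (besselJ 0 v : ℂ) / (2 * v))
      ((((-besselJ 1 u : ℝ) : ℂ) * (2 * u) - (besselJ 0 u : ℂ) * 2) / (2 * u) ^ 2) u := by
    have hd : HasDerivAt (fun v : ℝ ↦ (2 * (v : ℂ))) 2 u := by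
      simpa using ((hasDerivAt_id u).ofReal_comp).const_mul (2 : ℂ)
    exact hJ0.div hd (by simpa using huC)
  have hB : HasDerivAt
      (fun v : ℝ ↦ (besselJ 0 v : ℂ) + I * ε * besselJ 1 v - I * ε * besselJ 0 v / (2 * v))
      (((-besselJ 1 u : ℝ) : ℂ) + I * ε * (((u * besselJ 0 u - besselJ 1 u) / u : ℝ) : ℂ)
        - I * ε * ((((-besselJ 1 u : ℝ) : ℂ) * (2 * u) - (besselJ 0 u : ℂ) * 2) / (2 * u) ^ 2)) u := by
    have := (hJ0.fun_add (hJ1.const_mul (I * ε))).fun_sub (hinv.const_mul (I * ε))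
    simpa [mul_div_assoc] using this
  have hW := hE.fun_mul hB
  refine hW.congr_deriv ?_
  push_cast
  field_simp
  ring_nf
  rw [I_sq, hε2]
  ring


/-- The second derivative of the envelope: `W_ε''(u) = e^{-iεu}(2uJ₀(u) + iεuJ₁(u) − 2iεJ₀(u))/(2u³)`
for `u ≠ 0` (again from `J₀' = −J₁`, `(uJ₁)' = uJ₀`). [cite: ConreyIwaniec2002, §4 before (4.23)] -/
theorem hasDerivAt_besselEnvelope_deriv {ε : ℝ} (hε : ε = 1 ∨ ε = -1) {u : ℝ} (hu : u ≠ 0) :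
    HasDerivAt
      (fun v : ℝ ↦ -(cexp (-(I * ε * v)) *
        (v * besselJ 0 v + I * ε * v * besselJ 1 v - I * ε * besselJ 0 v)) / (2 * v ^ 2))
      (cexp (-(I * ε * u)) *
        (2 * u * besselJ 0 u + I * ε * u * besselJ 1 u - 2 * I * ε * besselJ 0 u) / (2 * u ^ 3)) u := by
  have hε2 : (ε : ℂ) ^ 2 = 1 := by
    rcases hε with h | h <;> simp [h]
  have huC : (u : ℂ) ≠ 0 := ofReal_ne_zero.mpr hu
  have hE : HasDerivAt (fun v : ℝ ↦ cexp (-(I * ε * v))) (cexp (-(I * ε * u)) * (-(I * ε))) u := by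
    have h1 : HasDerivAt (fun v : ℝ ↦ -(I * ε * (v : ℂ))) (-(I * ε)) u := by
      have := ((hasDerivAt_id u).ofReal_comp).const_mul (I * ε)
      simpa using this.fun_neg
    exact h1.cexp
  have hv : HasDerivAt (fun v : ℝ ↦ (v : ℂ)) 1 u := (hasDerivAt_id u).ofReal_comp
  have hJ0 : HasDerivAt (fun v : ℝ ↦ (besselJ 0 v : ℂ)) ((-besselJ 1 u : ℝ) : ℂ) u :=
    (hasDerivAt_besselJ_zero_holds u).ofReal_comp
  have hJ1u : HasDerivAt (fun v : ℝ ↦ ((v : ℂ) * besselJ 1 v)) ((u * besselJ 0 u : ℝ) : ℂ) u := by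
    have := (hasDerivAt_mul_besselJ_one u).ofReal_comp
    simpa using this
  have hN : HasDerivAt
      (fun v : ℝ ↦ (v : ℂ) * besselJ 0 v + I * ε * v * besselJ 1 v - I * ε * besselJ 0 v)
      (1 * (besselJ 0 u : ℂ) + (u : ℂ) * ((-besselJ 1 u : ℝ) : ℂ) + I * ε * ((u * besselJ 0 u : ℝ) : ℂ)
        - I * ε * ((-besselJ 1 u : ℝ) : ℂ)) u := by
    have := ((hv.fun_mul hJ0).fun_add (hJ1u.const_mul (I * ε))).fun_sub (hJ0.const_mul (I * ε))
    simpa [mul_assoc] using this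
  have hD : HasDerivAt (fun v : ℝ ↦ (2 * (v : ℂ) ^ 2)) (2 * (2 * (u : ℂ) ^ 1 * 1)) u :=
    ((hv.fun_pow 2)).const_mul 2
  have hW := ((hE.fun_mul hN).fun_neg).fun_div hD (by simpa using huC)
  refine hW.congr_deriv ?_
  push_cast
  field_simp
  ring_nf
  rw [I_sq, hε2]
  ring


/-- `‖x + iεy − iεz‖ ≤ ‖x‖ + ‖y‖ + ‖z‖` for `ε = ±1`. [folklore] -/
private theorem norm_add_sub_le_three {ε : ℝ} (hε : ε = 1 ∨ ε = -1) (x y z : ℂ) :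
    ‖x + I * ε * y - I * ε * z‖ ≤ ‖x‖ + ‖y‖ + ‖z‖ := by
  have hεn : ‖(ε : ℂ)‖ = 1 := by
    rcases hε with h | h <;> simp [h]
  calc ‖x + I * ε * y - I * ε * z‖ ≤ ‖x + I * ε * y‖ + ‖I * ε * z‖ := norm_sub_le _ _
    _ ≤ ‖x‖ + ‖I * ε * y‖ + ‖I * ε * z‖ := by gcongr; exact norm_add_le _ _
    _ = ‖x‖ + ‖y‖ + ‖z‖ := by simp only [norm_mul, Complex.norm_I, hεn, one_mul]

/-- `‖e^{-iεu}‖ = 1` for real `ε`, `u`. [folklore] -/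
private theorem norm_cexp_neg_I_mul (ε u : ℝ) : ‖cexp (-(I * ε * u))‖ = 1 := by
  rw [norm_exp]
  simp

/-- **Symbol bounds for the envelope.** There is an absolute `K ≥ 0` such that for `ε = ±1` and
`u ≥ 2`: `|W_ε(u)| ≤ K u^{-1/2}`, `|W_ε'(u)| ≤ K u^{-3/2}`, `|W_ε''(u)| ≤ K u^{-5/2}` — the bounds
`y^νW^{(ν)}(y) ≪ y^{-1/2}` (`ν = 0, 1, 2`) that Conrey–Iwaniec quote before (4.23), obtained here
from the tree's elementary decay `|J_n(u)| ≤ C_n u^{-1/2}` (`abs_besselJ_le_mul_rpow_neg_half`) and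
the explicit formulae for `W_ε'`, `W_ε''`. [cite: ConreyIwaniec2002, §4 before (4.23)] -/
theorem besselEnvelope_bounds :
    ∃ K : ℝ, 0 ≤ K ∧ ∀ ε : ℝ, (ε = 1 ∨ ε = -1) → ∀ u : ℝ, 2 ≤ u →
      ‖cexp (-(I * ε * u)) *
          ((besselJ 0 u : ℂ) + I * ε * besselJ 1 u - I * ε * besselJ 0 u / (2 * u))‖ ≤
        K / Real.sqrt u ∧
      ‖-(cexp (-(I * ε * u)) *
          (u * besselJ 0 u + I * ε * u * besselJ 1 u - I * ε * besselJ 0 u)) / (2 * u ^ 2)‖ ≤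
        K / (u * Real.sqrt u) ∧
      ‖cexp (-(I * ε * u)) *
          (2 * u * besselJ 0 u + I * ε * u * besselJ 1 u - 2 * I * ε * besselJ 0 u) / (2 * u ^ 3)‖ ≤
        K / (u ^ 2 * Real.sqrt u) := by
  obtain ⟨C₀, hC₀⟩ := abs_besselJ_le_mul_rpow_neg_half 0
  obtain ⟨C₁, hC₁⟩ := abs_besselJ_le_mul_rpow_neg_half 1
  refine ⟨2 * (|C₀| + |C₁|), by positivity, ?_⟩
  intro ε hε u hu
  have hu0 : 0 < u := by linarith
  have hsq : 0 < Real.sqrt u := Real.sqrt_pos.mpr hu0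
  have hrpow : u ^ (-(1 / 2 : ℝ)) = (Real.sqrt u)⁻¹ := by
    rw [Real.rpow_neg hu0.le, Real.sqrt_eq_rpow]
  -- the two Bessel bounds, in the form `|J_n(u)| ≤ |C_n|/√u`
  have hJ0 : ‖(besselJ 0 u : ℂ)‖ ≤ |C₀| / Real.sqrt u := by
    rw [Complex.norm_real, Real.norm_eq_abs]
    have h := hC₀ u (by push_cast; linarith)
    rw [hrpow] at h
    calc |besselJ 0 u| ≤ C₀ * (Real.sqrt u)⁻¹ := h
      _ ≤ |C₀| * (Real.sqrt u)⁻¹ := by gcongr; exact le_abs_self _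
      _ = |C₀| / Real.sqrt u := by rw [div_eq_mul_inv]
  have hJ1 : ‖(besselJ 1 u : ℂ)‖ ≤ |C₁| / Real.sqrt u := by
    rw [Complex.norm_real, Real.norm_eq_abs]
    have h := hC₁ u (by push_cast; linarith)
    rw [hrpow] at h
    calc |besselJ 1 u| ≤ C₁ * (Real.sqrt u)⁻¹ := h
      _ ≤ |C₁| * (Real.sqrt u)⁻¹ := by gcongr; exact le_abs_self _
      _ = |C₁| / Real.sqrt u := by rw [div_eq_mul_inv]
  have hE := norm_cexp_neg_I_mul ε u
  have huC : ‖(u : ℂ)‖ = u := by rw [Complex.norm_real, Real.norm_eq_abs, abs_of_pos hu0]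
  have hA0 : 0 ≤ |C₀| := abs_nonneg _
  have hA1 : 0 ≤ |C₁| := abs_nonneg _
  refine ⟨?_, ?_, ?_⟩
  · -- `W`
    rw [norm_mul, hE, one_mul]
    calc ‖(besselJ 0 u : ℂ) + I * ε * besselJ 1 u - I * ε * besselJ 0 u / (2 * u)‖
        ≤ ‖(besselJ 0 u : ℂ)‖ + ‖(besselJ 1 u : ℂ)‖ + ‖(besselJ 0 u : ℂ) / (2 * u)‖ := by
          have h := norm_add_sub_le_three hε (besselJ 0 u : ℂ) (besselJ 1 u) (besselJ 0 u / (2 * u))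
          rw [mul_div_assoc]
          exact h
      _ = ‖(besselJ 0 u : ℂ)‖ + ‖(besselJ 1 u : ℂ)‖ + ‖(besselJ 0 u : ℂ)‖ / (2 * u) := by
          rw [norm_div, norm_mul, huC, Complex.norm_two]
      _ ≤ |C₀| / Real.sqrt u + |C₁| / Real.sqrt u + (|C₀| / Real.sqrt u) / (2 * u) := by
          gcongr
      _ ≤ 2 * (|C₀| + |C₁|) / Real.sqrt u := by
          have h2 : |C₀| / Real.sqrt u / (2 * u) ≤ |C₀| / Real.sqrt u :=
            div_le_self (by positivity) (by linarith)
          have e : 2 * (|C₀| + |C₁|) / Real.sqrt u =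
              2 * (|C₀| / Real.sqrt u) + 2 * (|C₁| / Real.sqrt u) := by ring
          have h4 : 0 ≤ |C₁| / Real.sqrt u := by positivity
          linarith
  · -- `W'`
    rw [norm_div, norm_neg, norm_mul, hE, one_mul, norm_mul, Complex.norm_two, norm_pow, huC]
    calc ‖(u : ℂ) * besselJ 0 u + I * ε * u * besselJ 1 u - I * ε * besselJ 0 u‖ / (2 * u ^ 2)
        ≤ (‖(u : ℂ) * besselJ 0 u‖ + ‖(u : ℂ) * besselJ 1 u‖ + ‖(besselJ 0 u : ℂ)‖) / (2 * u ^ 2) := by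
          gcongr
          have h := norm_add_sub_le_three hε ((u : ℂ) * besselJ 0 u) ((u : ℂ) * besselJ 1 u)
            (besselJ 0 u)
          have e : (u : ℂ) * besselJ 0 u + I * ε * u * besselJ 1 u - I * ε * besselJ 0 u =
              (u : ℂ) * besselJ 0 u + I * ε * ((u : ℂ) * besselJ 1 u) - I * ε * besselJ 0 u := by
            ring
          rwa [e]
      _ = (u * ‖(besselJ 0 u : ℂ)‖ + u * ‖(besselJ 1 u : ℂ)‖ + ‖(besselJ 0 u : ℂ)‖) / (2 * u ^ 2) := by
          rw [norm_mul, norm_mul, huC]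
      _ ≤ (u * (|C₀| / Real.sqrt u) + u * (|C₁| / Real.sqrt u) + |C₀| / Real.sqrt u) /
            (2 * u ^ 2) := by gcongr
      _ ≤ 2 * (|C₀| + |C₁|) / (u * Real.sqrt u) := by
          have e1 : (u * (|C₀| / Real.sqrt u) + u * (|C₁| / Real.sqrt u) + |C₀| / Real.sqrt u) /
              (2 * u ^ 2) = (u * |C₀| + u * |C₁| + |C₀|) / (2 * u ^ 2 * Real.sqrt u) := by
            field_simp
          have e2 : 2 * (|C₀| + |C₁|) / (u * Real.sqrt u) =
              (4 * u * (|C₀| + |C₁|)) / (2 * u ^ 2 * Real.sqrt u) := by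
            field_simp
            ring
          rw [e1, e2]
          exact div_le_div_of_nonneg_right (by nlinarith) (by positivity)
  · -- `W''`
    rw [norm_div, norm_mul, hE, one_mul, norm_mul, Complex.norm_two, norm_pow, huC]
    calc ‖2 * (u : ℂ) * besselJ 0 u + I * ε * u * besselJ 1 u - 2 * I * ε * besselJ 0 u‖ / (2 * u ^ 3)
        ≤ (‖2 * (u : ℂ) * besselJ 0 u‖ + ‖(u : ℂ) * besselJ 1 u‖ + ‖2 * (besselJ 0 u : ℂ)‖) /
            (2 * u ^ 3) := by
          gcongr
          have h := norm_add_sub_le_three hε (2 * (u : ℂ) * besselJ 0 u) ((u : ℂ) * besselJ 1 u)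
            (2 * besselJ 0 u)
          have e : 2 * (u : ℂ) * besselJ 0 u + I * ε * u * besselJ 1 u - 2 * I * ε * besselJ 0 u =
              2 * (u : ℂ) * besselJ 0 u + I * ε * ((u : ℂ) * besselJ 1 u) - I * ε * (2 * besselJ 0 u) := by
            ring
          rwa [e]
      _ = (2 * u * ‖(besselJ 0 u : ℂ)‖ + u * ‖(besselJ 1 u : ℂ)‖ + 2 * ‖(besselJ 0 u : ℂ)‖) /
            (2 * u ^ 3) := by
          rw [norm_mul, norm_mul, norm_mul, norm_mul, huC, Complex.norm_two]
      _ ≤ (2 * u * (|C₀| / Real.sqrt u) + u * (|C₁| / Real.sqrt u) + 2 * (|C₀| / Real.sqrt u)) /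
            (2 * u ^ 3) := by gcongr
      _ ≤ 2 * (|C₀| + |C₁|) / (u ^ 2 * Real.sqrt u) := by
          have e1 : (2 * u * (|C₀| / Real.sqrt u) + u * (|C₁| / Real.sqrt u) +
              2 * (|C₀| / Real.sqrt u)) / (2 * u ^ 3) =
              (2 * u * |C₀| + u * |C₁| + 2 * |C₀|) / (2 * u ^ 3 * Real.sqrt u) := by
            field_simp
          have e2 : 2 * (|C₀| + |C₁|) / (u ^ 2 * Real.sqrt u) =
              (4 * u * (|C₀| + |C₁|)) / (2 * u ^ 3 * Real.sqrt u) := by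
            field_simp
            ring
          rw [e1, e2]
          exact div_le_div_of_nonneg_right (by nlinarith) (by positivity)

/-- The second derivative of the envelope is continuous away from `0`. [cite: ConreyIwaniec2002, §4 before (4.23)] -/
theorem continuousAt_besselEnvelope_deriv2 (ε : ℝ) {u : ℝ} (hu : u ≠ 0) :
    ContinuousAt (fun v : ℝ ↦ cexp (-(I * ε * v)) *
        (2 * v * besselJ 0 v + I * ε * v * besselJ 1 v - 2 * I * ε * besselJ 0 v) / (2 * v ^ 3)) u := by
  have hJ0 : Continuous fun v : ℝ ↦ (besselJ 0 v : ℂ) :=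
    continuous_ofReal.comp (continuous_besselJ_holds 0)
  have hJ1 : Continuous fun v : ℝ ↦ (besselJ 1 v : ℂ) :=
    continuous_ofReal.comp (continuous_besselJ_holds 1)
  have hv : Continuous fun v : ℝ ↦ (v : ℂ) := continuous_ofReal
  refine ContinuousAt.div ?_ ?_ (by simpa using ofReal_ne_zero.mpr hu)
  · refine (Continuous.continuousAt ?_)
    refine (Continuous.cexp ?_).mul ?_
    · exact ((continuous_const.mul hv)).neg
    · exact ((((continuous_const.mul hv).mul hJ0).add
        (((continuous_const.mul hv)).mul hJ1)).sub (continuous_const.mul hJ0))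
  · exact (continuous_const.mul (hv.pow 3)).continuousAt

/-- **`J₀` as the sum of two oscillating envelopes**: for every real `u`,
`J₀(u) = ½(e^{iu}W₊(u) + e^{-iu}W₋(u))` with `W_ε(u) = e^{-iεu}(J₀(u) + iεJ₁(u) − iεJ₀(u)/(2u))`
(`ε = ±1`; the `J₁`-terms cancel) — the form `J₀(2πy) = W(y)e(y) + W̄(y)e(−y)` used in
(4.22)–(4.23). [cite: ConreyIwaniec2002, §4 before (4.23)] -/
theorem besselJ_zero_eq_envelope_sum (u : ℝ) :
    (besselJ 0 u : ℂ) =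
      (cexp (I * ((1 : ℝ) * u)) * (cexp (-(I * (1 : ℝ) * u)) *
          ((besselJ 0 u : ℂ) + I * (1 : ℝ) * besselJ 1 u - I * (1 : ℝ) * besselJ 0 u / (2 * u))) +
        cexp (I * ((-1 : ℝ) * u)) * (cexp (-(I * (-1 : ℝ) * u)) *
          ((besselJ 0 u : ℂ) + I * (-1 : ℝ) * besselJ 1 u - I * (-1 : ℝ) * besselJ 0 u / (2 * u)))) /
        2 := by
  have h1 : cexp (I * ((1 : ℝ) * u)) * cexp (-(I * (1 : ℝ) * u)) = 1 := by
    rw [← Complex.exp_add]; push_cast; ring_nf; exact Complex.exp_zero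
  have h2 : cexp (I * ((-1 : ℝ) * u)) * cexp (-(I * (-1 : ℝ) * u)) = 1 := by
    rw [← Complex.exp_add]; push_cast; ring_nf; exact Complex.exp_zero
  rw [← mul_assoc, h1, ← mul_assoc, h2]
  push_cast
  ring

end ConreyIwaniec2002

end Literature.NumberTheory.LFunctions

end
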